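import Mathlib
import HarnessLib
import Literature.AlgebraicTopology.SingularHomology.PoincareDuality
import Literature.AlgebraicTopology.SingularHomology.IntersectionForm
import Literature.Geometry.Symplectic.SteinDomain
import Summits.SmoothPoincare4.SmoothPoincare4.Theses.SymplecticOrigami

/-!
# Sketch — first lemmas for the crux-ideate cards on `NoGenusTwoDoor` (stmt-SmoothPoincare4-7842)

Ideator 1, round 1. Each `def … : Prop` below is the Lean shadow of the FIRST checkable statement
of one idea card; none is proved here (crux-ideate files no skeleton). A "door" is a closed
symplectic 4-manifold with `(b₁, b₂) = (2, 1)`; the lemmas isolate the purely cohomological input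
`b₂ = 1` + nondegenerate pairing, stated over `ℚ` with the tree's singular (co)homology API.
-/

namespace Summit.SmoothPoincare4.SmoothPoincare4.Cruxes.NoGenusTwoDoor.IdeatorOne

open scoped Manifold ContDiff
open Literature.AlgebraicTopology.SingularHomology

/-- Card `picard-loop-classes`, first lemma (D1 in NOTES): on a closed oriented 4-manifold with
`b₂ = 1` (over `ℚ`) the cup product of two degree-one classes vanishes:
`(a ⌣ b) ⌣ (a ⌣ b) = -(a ⌣ a) ⌣ (b ⌣ b) = 0` while a nonzero element of the rank-one `H²`
has nonzero square by perfectness. This is the input that kills every PURE wall-crossing number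
of a door (families index over the Picard torus) and leaves the loop-inserted ones equal to `±1`.
Hypotheses D-0014 style: graded commutativity and perfectness of the cup pairing are the tree's
named facts. -/
def DoorCupOneOneVanishes : Prop :=
  ∀ (N : Type) [TopologicalSpace N] [T2Space N] [CompactSpace N]
    [ChartedSpace (EuclideanSpace ℝ (Fin 4)) N] (μ : HomologicalOrientation ℚ N 4),
    cupProduct_gradedComm ℚ N →
    isPerfPair_cupPairing_of_field μ (show 2 + 2 = 4 from rfl) →
    Module.finrank ℚ (singularCohomology ℚ ℚ N 2) = 1 →
    ∀ a b : singularCohomology ℚ ℚ N 1, cupProduct (show 1 + 1 = 2 from rfl) a b = 0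

/-- Card `picard-loop-classes` / `liouville-genus-two-complement`, second lemma (D1):
the Lefschetz-type map `H¹ → H³`, `a ↦ a ⌣ c`, vanishes for EVERY degree-two class `c` on such a
manifold (pair `a ⌣ c` against `b ∈ H¹`: `⟨a ⌣ c ⌣ b⟩ = ±⟨(a ⌣ b) ⌣ c⟩ = 0`, then perfectness of
`H³ × H¹ → ℚ`). For a door: `[ω] ⌣ H¹ = 0`, the Albanese map has degree `0`, and every closed
1-form `θ` has `θ ∧ ω` exact. -/
def DoorLefschetzMapVanishes : Prop :=
  ∀ (N : Type) [TopologicalSpace N] [T2Space N] [CompactSpace N]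
    [ChartedSpace (EuclideanSpace ℝ (Fin 4)) N] (μ : HomologicalOrientation ℚ N 4),
    cupProduct_gradedComm ℚ N →
    isPerfPair_cupPairing_of_field μ (show 2 + 2 = 4 from rfl) →
    isPerfPair_cupPairing_of_field μ (show 3 + 1 = 4 from rfl) →
    Module.finrank ℚ (singularCohomology ℚ ℚ N 2) = 1 →
    ∀ (a : singularCohomology ℚ ℚ N 1) (c : singularCohomology ℚ ℚ N 2),
      cupProduct (show 1 + 2 = 3 from rfl) a c = 0

/-- Card `liouville-genus-two-complement`, first lemma (exactness shadow of D4): with `b₂ = 1`,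
if one nonzero degree-two class dies under pull-back along `f : U → N` (for the door: `U = N ∖ B`,
the class `PD[B]`), then EVERY degree-two class dies — in particular the symplectic class, so
`ω|_{N ∖ B}` is exact and `N ∖ ν(B)` is a Liouville (not merely strong) filling of its contact
boundary. Pure rank-one linear algebra; recorded because it is exactly where `b₂ = 1` enters. -/
def RankOnePullbackVanishes : Prop :=
  ∀ (N U : Type) [TopologicalSpace N] [TopologicalSpace U],
    Module.finrank ℚ (singularCohomology ℚ ℚ N 2) = 1 →
    ∀ (f : C(U, N)) (c : singularCohomology ℚ ℚ N 2), c ≠ 0 →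
      singularCohomology.map ℚ ℚ f 2 c = 0 →
      ∀ x : singularCohomology ℚ ℚ N 2, singularCohomology.map ℚ ℚ f 2 x = 0

/-- Card `liouville-genus-two-complement`, the transfer target `C⁺` in the only form the tree can
type today (the boundary condition "∂W is the Euler-number-one prequantization circle bundle over
Σ₂ with its Boothby–Wang contact structure" is the definition request D1 of the card and appears
here as an abstract predicate `IsGenusTwoDegreeOneBoundary`): every 4-dimensional Liouville
domain with that boundary has `χ ≥ 2`, written `b₂ + b₀ ≥ b₁ + b₃ + 2` over `ℚ`
(`b₄ = 0` for a compact manifold with nonempty boundary). A door complement would have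
`(b₀, b₁, b₂, b₃) = (1, 2, 2 + κ, κ)`, i.e. `χ = 1`. -/
def ExactFillingEulerBound
    (IsGenusTwoDegreeOneBoundary : ∀ (W : Type) [TopologicalSpace W]
      [ChartedSpace (EuclideanHalfSpace 4) W], Prop) : Prop :=
  ∀ (W : Type) [TopologicalSpace W] [T2Space W] [SecondCountableTopology W] [CompactSpace W]
    [ConnectedSpace W] [ChartedSpace (EuclideanHalfSpace 4) W] [IsManifold (𝓡∂ 4) ∞ W]
    (lam : Literature.Geometry.Kaehler.MForm (𝓡∂ 4) W ℝ 1),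
    Literature.Geometry.Symplectic.IsLiouvilleDomain W lam →
    IsGenusTwoDegreeOneBoundary W →
    bettiNumber ℚ W 1 + bettiNumber ℚ W 3 + 2 ≤ bettiNumber ℚ W 0 + bettiNumber ℚ W 2

/-- Card `weinstein-door-presentation`, first lemma (Stein shadow, D7): a compact Stein surface
has no rational homology in degrees `3` and `4` (handle indices `≤ 2`: Eliashberg 1990 / Milnor's
Morse-theory argument, Gompf 1998 §1). Consequence for a door whose Taubes-curve complement `W`
is Stein: `κ_B = b₃(W) = 0`, i.e. `H₁(B; ℚ) → H₁(N; ℚ)` is onto and `π₁(∂W) ↠ π₁(W) ↠ π₁(N)`,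
which is what makes the Legendrian-surgery presentation of the card finite-dimensional. -/
def SteinDomainTopVanishing : Prop :=
  ∀ (W : Type) [TopologicalSpace W] [T2Space W] [SecondCountableTopology W] [CompactSpace W]
    [ChartedSpace (EuclideanHalfSpace 4) W] [IsManifold (𝓡∂ 4) ∞ W],
    Literature.Geometry.Symplectic.IsSteinDomain W → bettiNumber ℚ W 3 = 0 ∧ bettiNumber ℚ W 4 = 0

/-- Sanity: the crux decl is in scope (the cards never restate or weaken it). -/
example : Prop := Summit.SmoothPoincare4.SmoothPoincare4.Theses.SymplecticOrigami.NoGenusTwoDoor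

end Summit.SmoothPoincare4.SmoothPoincare4.Cruxes.NoGenusTwoDoor.IdeatorOne
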